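import Literature.Analysis.FluidPDE.ForwardDSSGaugedPressure
import Literature.Analysis.FluidPDE.ForwardDSSRunningSup
import Literature.Analysis.FluidPDE.LocalLerayInitialEnergyGradient
import Literature.Analysis.FluidPDE.UlocCubicInterpolation
import HarnessLib

/-!
# Forward DSS solutions: the a priori estimate (3.12) of Bradshaw–Tsai 2019 for **every**
  `λ`-DSS local Leray solution

Analysis/FluidPDE proof file (theorems only, no new definitions) under the named fact
`Literature.Analysis.FluidPDE.bradshawTsai2019_prop_3_1` (Bradshaw–Tsai, Analysis & PDE 12
(2019) = arXiv:1801.08060, Prop. 3.1; `ForwardDSSExistence.lean`). The printed Prop. 3.1 is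
stated for "the `λ`-DSS local Leray solution constructed in [BT1]" and proved on the smooth
mollified approximants of that construction (pp. 8–10), where the local energy *equality* (3.7)
and the continuity of `α_ε(t) = ∫_{B₁}|v_ε(t)|²` are available. Every step of pp. 8–10 has a
counterpart for an arbitrary `λ`-DSS local Leray solution `(v, π)` (Kang–Miura–Tsai Def. 3.2 =
`IsLocalLeraySolution 1 v₀ v π`), the equality (3.7) being replaced by the local energy
inequality from the initial time (accepted
`IsLocalLeraySolution.ae_lintegral_sq_mul_add_grad_le_datum_add`), the pressure formula (3.8) by
the Kang–Miura–Tsai expansion of the gauged pressure (accepted `exists_gaugedPressure`,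
`exists_gaugedPressure_cylinder_le`, with Stein's bound **CZ** as hypothesis), the continuity of
`α_ε` by the running essential supremum `α̃(t) = esssup_{s<t} α(s)` (accepted
`ForwardDSSRunningSup`), and the Gagliardo–Nirenberg inequality (3.11) by the slice interpolation
for weak gradients on the unit ball (accepted `exists_lintegral_ball_cube_le`). This file proves
the resulting estimate:

* `exists_apriori_ae` — **(3.12) for every `λ`-DSS local Leray solution, a.e. in time.** Fix
  `λ > 1`. There is `K = K(λ) < ∞` such that for every local Leray solution `(v, ϖ)` with
  measurable datum `v₀`, `v` `λ`-DSS, `G = ∇v` a weak spatial gradient on the slab, `ϖ` gauged on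
  `B_λ` (`ϖ = π_loc + π_far` a.e. on `(0,1) × B_λ`) and `∫∫_{(0,1)×B₁}|∇v|² < ∞`:
  for a.e. `s ∈ (0,1)`,
  `α(s) + ∫∫_{(0,s)×B₁}|∇v|² ≤ ‖v₀‖²_{L²(B_λ)} + K∫₀ˢ(α̃³ + α̃)` (the printed (3.12) with `α̃` the
  running essential supremum), and for every `s ∈ (0,1]`,
  `∫∫_{(0,s)×B_λ}|ϖ|^{3/2} ≤ K(∫∫_{(0,s)×B₁}|∇v|² + ∫₀ˢ(α̃³ + α̃))` (the pressure bound of p. 10).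

Proof (pp. 8–10): the local energy inequality from `t = 0` with the weight `ψ` (`ψ = 1` on `B₁`,
supported in `B_λ`; `exists_unit_cutoff`) bounds `α(s) + 2∫∫|∇v|²` by
`‖v₀‖²_{L²(B_λ)} + ∫∫_{(0,s)×B_λ}(|Δψ||v|² + |∇ψ|(|v|³ + 2|ϖ||v|))` (`lintegral_enorm_flux_le`, with
Young `|ϖ||v| ≤ |ϖ|^{3/2} + |v|³`); the quadratic term is `≤ λ‖Δψ‖_∞∫₀ˢα̃` by the sliced scaling
law (3.6) and `α(λ⁻²s) ≤ α̃(s)`; the cubic terms on `B_λ`, `B_{2λ}` are sent to the unit cylinder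
by (3.6) (accepted `setLIntegral_cylinder_enorm_cube_le_of_dss`) and bounded slice-wise by
`C α^{3/4}(α^{3/4} + (∫_{B₁}|∇v|²)^{3/4})` and Young (`slice_cube_le`), the gradient part being
absorbed into the left-hand side (finite dissipation); the pressure term is the cylinder bound of
the gauged pressure; and `α ≤ λα̃` (from `B₁ ⊂ B_λ` and (3.6)).

## References

* Z. Bradshaw, T.-P. Tsai, Analysis & PDE 12 (2019) 1943–1962 = arXiv:1801.08060, §3, Prop. 3.1
  and its proof: (3.6), (3.7), (3.9)–(3.12), the pressure bounds of p. 10 [BradshawTsai2019].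
* K. Kang, H. Miura, T.-P. Tsai, IMRN 2021 = arXiv:1812.10509, Def. 3.2, Lemma 3.4
  [KangMiuraTsai2020].
-/

noncomputable section

open MeasureTheory Set Function Filter Topology TopologicalSpace Metric
open scoped NNReal ENNReal RealInnerProductSpace Laplacian

namespace Literature.Analysis.FluidPDE

namespace BradshawTsai2019

/-! ## The cut-off -/

/-- **The spatial cut-off of Bradshaw–Tsai 2019, p. 8** ("Fix `χ ∈ C^∞` with `0 ≤ χ ≤ 1`,
`χ(x) = 1` on `B(0,1)`, and `supp(χ) ⊂ B(0,λ)`. Let `φ(x,t) = χ²`"), here a smooth bump `ψ` with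
`0 ≤ ψ ≤ 1`, `ψ = 1` on `B₁`, `tsupport ψ ⊆ B̄_{(1+λ)/2} ⊂ B_λ`, and finite bounds for `∇ψ` and
`Δψ`. [cite: BradshawTsai2019, §3 proof of Prop 3.1 (the cut-off, p. 8)] -/
theorem exists_unit_cutoff {c : ℝ} (hc : 1 < c) :
    ∃ ψ : EuclideanSpace ℝ (Fin 3) → ℝ, ContDiff ℝ (⊤ : ℕ∞) ψ ∧ HasCompactSupport ψ ∧
      (∀ x, 0 ≤ ψ x) ∧ (∀ x, ψ x ≤ 1) ∧ (∀ x ∈ ball (0 : EuclideanSpace ℝ (Fin 3)) 1, ψ x = 1) ∧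
      tsupport ψ ⊆ ball (0 : EuclideanSpace ℝ (Fin 3)) c ∧
      ∃ Mg MΔ : ℝ, 0 ≤ Mg ∧ 0 ≤ MΔ ∧ (∀ x, ‖gradient ψ x‖ ≤ Mg) ∧ ∀ x, ‖(Δ ψ) x‖ ≤ MΔ := by
  let f : ContDiffBump (0 : EuclideanSpace ℝ (Fin 3)) := ⟨1, (1 + c) / 2, one_pos, by linarith⟩
  have hrIn : f.rIn = 1 := rfl
  have hrOut : f.rOut = (1 + c) / 2 := rfl
  have hs : ContDiff ℝ (⊤ : ℕ∞) f := f.contDiff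
  have hs1 : ContDiff ℝ 1 f := f.contDiff
  have hs2 : ContDiff ℝ 2 f := f.contDiff
  have hcs : HasCompactSupport f := f.hasCompactSupport
  have hts : tsupport (f : EuclideanSpace ℝ (Fin 3) → ℝ) ⊆ ball (0 : EuclideanSpace ℝ (Fin 3)) c := by
    rw [f.tsupport_eq, hrOut]
    exact closedBall_subset_ball (by linarith)
  -- the gradient
  have hgc : Continuous (gradient (f : EuclideanSpace ℝ (Fin 3) → ℝ)) :=
    continuous_gradient_of_contDiff hs1
  have hgcs : HasCompactSupport (gradient (f : EuclideanSpace ℝ (Fin 3) → ℝ)) :=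
    HasCompactSupport.intro hcs.isCompact fun x hx => gradient_eq_zero_of_notMem_tsupport hx
  obtain ⟨Mg, hMg⟩ := hgc.bounded_above_of_compact_support hgcs
  -- the Laplacian
  have hΔc : Continuous (Δ (f : EuclideanSpace ℝ (Fin 3) → ℝ)) := continuous_laplacian hs2
  have hΔcs : HasCompactSupport (Δ (f : EuclideanSpace ℝ (Fin 3) → ℝ)) :=
    HasCompactSupport.intro hcs.isCompact fun x hx => laplacian_eq_zero_of_notMem_tsupport hx
  obtain ⟨MΔ, hMΔ⟩ := hΔc.bounded_above_of_compact_support hΔcs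
  refine ⟨f, hs, hcs, fun x => f.nonneg, fun x => f.le_one, fun x hx => ?_, hts, max Mg 0,
    max MΔ 0, le_max_right _ _, le_max_right _ _, fun x => (hMg x).trans (le_max_left _ _),
    fun x => (hMΔ x).trans (le_max_left _ _)⟩
  exact f.one_of_mem_closedBall (by rw [hrIn]; exact ball_subset_closedBall hx)

/-! ## The flux integrand of the local energy inequality -/

/-- **The moduli of the right-hand side of (3.7)** (Bradshaw–Tsai 2019, pp. 9–10, where each term
of (3.7) is bounded through its modulus, the pressure term by Hölder/Young): if
`‖∇ψ‖ ≤ M_g`, `|Δψ| ≤ M_Δ` everywhere, then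
`∫∫_S | |v|²Δψ + (|v|² + 2ϖ) v·∇ψ | ≤ M_Δ∫∫_S|v|² + 3M_g∫∫_S|v|³ + 2M_g∫∫_S|ϖ|^{3/2}`
(`|ϖ||v| ≤ |ϖ|^{3/2} + |v|³`). [cite: BradshawTsai2019, §3 proof of Prop 3.1 (pp. 9–10)] -/
theorem lintegral_enorm_flux_le {S : Set (ℝ × EuclideanSpace ℝ (Fin 3))}
    {v : ℝ → EuclideanSpace ℝ (Fin 3) → EuclideanSpace ℝ (Fin 3)}
    {ϖ : ℝ → EuclideanSpace ℝ (Fin 3) → ℝ} {ψ : EuclideanSpace ℝ (Fin 3) → ℝ} {Mg MΔ : ℝ}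
    (hMg : 0 ≤ Mg) (hMΔ : 0 ≤ MΔ) (hg : ∀ x, ‖gradient ψ x‖ ≤ Mg) (hΔ : ∀ x, ‖(Δ ψ) x‖ ≤ MΔ)
    (hvm : AEStronglyMeasurable (uncurry v) (volume.restrict S)) :
    ∫⁻ z in S, ‖‖v z.1 z.2‖ ^ 2 * Δ ψ z.2 +
        (‖v z.1 z.2‖ ^ 2 + 2 * ϖ z.1 z.2) * ⟪v z.1 z.2, gradient ψ z.2⟫‖ₑ ≤
      ENNReal.ofReal MΔ * (∫⁻ z in S, ‖v z.1 z.2‖ₑ ^ 2) +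
        3 * ENNReal.ofReal Mg * (∫⁻ z in S, ‖v z.1 z.2‖ₑ ^ (3 : ℕ)) +
        2 * ENNReal.ofReal Mg * ∫⁻ z in S, ‖ϖ z.1 z.2‖ₑ ^ (3 / 2 : ℝ) := by
  -- the pointwise bound
  have hpt : ∀ z : ℝ × EuclideanSpace ℝ (Fin 3),
      ‖‖v z.1 z.2‖ ^ 2 * Δ ψ z.2 + (‖v z.1 z.2‖ ^ 2 + 2 * ϖ z.1 z.2) * ⟪v z.1 z.2, gradient ψ z.2⟫‖ₑ ≤
        ENNReal.ofReal MΔ * ‖v z.1 z.2‖ₑ ^ 2 + 3 * ENNReal.ofReal Mg * ‖v z.1 z.2‖ₑ ^ (3 : ℕ) +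
          2 * ENNReal.ofReal Mg * ‖ϖ z.1 z.2‖ₑ ^ (3 / 2 : ℝ) := by
    intro z
    set n : ℝ := ‖v z.1 z.2‖ with hn
    set p : ℝ := ϖ z.1 z.2 with hp
    have hn0 : 0 ≤ n := norm_nonneg _
    have hi : |⟪v z.1 z.2, gradient ψ z.2⟫| ≤ n * Mg :=
      (abs_real_inner_le_norm _ _).trans (mul_le_mul_of_nonneg_left (hg _) hn0)
    have hd : |Δ ψ z.2| ≤ MΔ := by simpa [Real.norm_eq_abs] using hΔ z.2
    -- the real inequality
    have hreal : |n ^ 2 * Δ ψ z.2 + (n ^ 2 + 2 * p) * ⟪v z.1 z.2, gradient ψ z.2⟫| ≤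
        MΔ * n ^ 2 + Mg * n ^ 3 + 2 * Mg * (|p| * n) := by
      calc |n ^ 2 * Δ ψ z.2 + (n ^ 2 + 2 * p) * ⟪v z.1 z.2, gradient ψ z.2⟫|
          ≤ |n ^ 2 * Δ ψ z.2| + |(n ^ 2 + 2 * p) * ⟪v z.1 z.2, gradient ψ z.2⟫| := abs_add_le _ _
        _ = n ^ 2 * |Δ ψ z.2| + |n ^ 2 + 2 * p| * |⟪v z.1 z.2, gradient ψ z.2⟫| := by
            rw [abs_mul, abs_mul, abs_of_nonneg (sq_nonneg n)]
        _ ≤ n ^ 2 * MΔ + (n ^ 2 + 2 * |p|) * (n * Mg) := by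
            gcongr
            · calc |n ^ 2 + 2 * p| ≤ |n ^ 2| + |2 * p| := abs_add_le _ _
                _ = n ^ 2 + 2 * |p| := by rw [abs_of_nonneg (sq_nonneg n), abs_mul, abs_two]
        _ = MΔ * n ^ 2 + Mg * n ^ 3 + 2 * Mg * (|p| * n) := by ring
    -- to `ℝ≥0∞`
    have e1 : ENNReal.ofReal (n ^ 2) = ‖v z.1 z.2‖ₑ ^ 2 := by
      rw [hn, ENNReal.ofReal_pow (norm_nonneg _), ofReal_norm]
    have e2 : ENNReal.ofReal (n ^ 3) = ‖v z.1 z.2‖ₑ ^ (3 : ℕ) := by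
      rw [hn, ENNReal.ofReal_pow (norm_nonneg _), ofReal_norm]
    have e3 : ENNReal.ofReal |p| = ‖ϖ z.1 z.2‖ₑ := by rw [hp, ← Real.enorm_eq_ofReal_abs]
    have e4 : ENNReal.ofReal n = ‖v z.1 z.2‖ₑ := by rw [hn, ofReal_norm]
    -- Young: `a b ≤ a^{3/2} + b³` (the tree's `BradshawTsai2017.mul_le_rpow_threeHalves_add_pow_three`,
    -- re-derived here so as not to import the periodic Leray chain)
    have hY : ∀ a b : ℝ≥0∞, a * b ≤ a ^ (3 / 2 : ℝ) + b ^ (3 : ℕ) := by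
      intro a b
      rcases le_total b (a ^ (1 / 2 : ℝ)) with h | h
      · calc a * b ≤ a * a ^ (1 / 2 : ℝ) := mul_le_mul' le_rfl h
          _ = a ^ (1 : ℝ) * a ^ (1 / 2 : ℝ) := by rw [ENNReal.rpow_one]
          _ = a ^ (3 / 2 : ℝ) := by
              rw [← ENNReal.rpow_add_of_nonneg _ _ (by norm_num : (0 : ℝ) ≤ 1)
                (by norm_num : (0 : ℝ) ≤ 1 / 2)]
              norm_num
          _ ≤ a ^ (3 / 2 : ℝ) + b ^ (3 : ℕ) := le_self_add
      · have hab : a ≤ b ^ (2 : ℕ) := by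
          have h2 := pow_le_pow_left' h 2
          rwa [← ENNReal.rpow_natCast, ← ENNReal.rpow_mul,
            show (1 / 2 : ℝ) * ((2 : ℕ) : ℝ) = 1 by norm_num, ENNReal.rpow_one] at h2
        calc a * b ≤ b ^ (2 : ℕ) * b := mul_le_mul' hab le_rfl
          _ = b ^ (3 : ℕ) := by ring
          _ ≤ a ^ (3 / 2 : ℝ) + b ^ (3 : ℕ) := le_add_self
    have hY := hY ‖ϖ z.1 z.2‖ₑ ‖v z.1 z.2‖ₑ
    calc ‖n ^ 2 * Δ ψ z.2 + (n ^ 2 + 2 * p) * ⟪v z.1 z.2, gradient ψ z.2⟫‖ₑ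
        = ENNReal.ofReal |n ^ 2 * Δ ψ z.2 + (n ^ 2 + 2 * p) * ⟪v z.1 z.2, gradient ψ z.2⟫| :=
          Real.enorm_eq_ofReal_abs _
      _ ≤ ENNReal.ofReal (MΔ * n ^ 2 + Mg * n ^ 3 + 2 * Mg * (|p| * n)) :=
          ENNReal.ofReal_le_ofReal hreal
      _ = ENNReal.ofReal MΔ * ‖v z.1 z.2‖ₑ ^ 2 + ENNReal.ofReal Mg * ‖v z.1 z.2‖ₑ ^ (3 : ℕ) +
            2 * ENNReal.ofReal Mg * (‖ϖ z.1 z.2‖ₑ * ‖v z.1 z.2‖ₑ) := by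
          rw [ENNReal.ofReal_add (by positivity) (by positivity),
            ENNReal.ofReal_add (by positivity) (by positivity), ENNReal.ofReal_mul hMΔ,
            ENNReal.ofReal_mul hMg, ENNReal.ofReal_mul (by positivity),
            ENNReal.ofReal_mul (abs_nonneg _), ENNReal.ofReal_mul zero_le_two, e1, e2, e3, e4,
            ENNReal.ofReal_ofNat]
      _ ≤ ENNReal.ofReal MΔ * ‖v z.1 z.2‖ₑ ^ 2 + ENNReal.ofReal Mg * ‖v z.1 z.2‖ₑ ^ (3 : ℕ) +
            2 * ENNReal.ofReal Mg * (‖ϖ z.1 z.2‖ₑ ^ (3 / 2 : ℝ) + ‖v z.1 z.2‖ₑ ^ (3 : ℕ)) := by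
          gcongr
      _ ≤ ENNReal.ofReal MΔ * ‖v z.1 z.2‖ₑ ^ 2 + 3 * ENNReal.ofReal Mg * ‖v z.1 z.2‖ₑ ^ (3 : ℕ) +
            2 * ENNReal.ofReal Mg * ‖ϖ z.1 z.2‖ₑ ^ (3 / 2 : ℝ) := by
          rw [mul_add]
          have : ENNReal.ofReal Mg * ‖v z.1 z.2‖ₑ ^ (3 : ℕ) +
              2 * ENNReal.ofReal Mg * ‖v z.1 z.2‖ₑ ^ (3 : ℕ) =
              3 * ENNReal.ofReal Mg * ‖v z.1 z.2‖ₑ ^ (3 : ℕ) := by ring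
          rw [← this]
          exact le_of_eq (by ring)
  -- measurability of the two velocity terms
  have hvme : AEMeasurable (fun z : ℝ × EuclideanSpace ℝ (Fin 3) => ‖v z.1 z.2‖ₑ)
      (volume.restrict S) := hvm.enorm
  have hA : AEMeasurable (fun z : ℝ × EuclideanSpace ℝ (Fin 3) =>
      ENNReal.ofReal MΔ * ‖v z.1 z.2‖ₑ ^ 2) (volume.restrict S) := (hvme.pow_const 2).const_mul _
  have hB : AEMeasurable (fun z : ℝ × EuclideanSpace ℝ (Fin 3) =>
      3 * ENNReal.ofReal Mg * ‖v z.1 z.2‖ₑ ^ (3 : ℕ)) (volume.restrict S) :=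
    (hvme.pow_const 3).const_mul _
  have hAB : AEMeasurable (fun z : ℝ × EuclideanSpace ℝ (Fin 3) =>
      ENNReal.ofReal MΔ * ‖v z.1 z.2‖ₑ ^ 2 + 3 * ENNReal.ofReal Mg * ‖v z.1 z.2‖ₑ ^ (3 : ℕ))
      (volume.restrict S) := hA.add hB
  have h3top : 3 * ENNReal.ofReal Mg ≠ ⊤ := ENNReal.mul_ne_top (by norm_num) ENNReal.ofReal_ne_top
  have h2top : 2 * ENNReal.ofReal Mg ≠ ⊤ := ENNReal.mul_ne_top (by norm_num) ENNReal.ofReal_ne_top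
  calc ∫⁻ z in S, ‖‖v z.1 z.2‖ ^ 2 * Δ ψ z.2 +
        (‖v z.1 z.2‖ ^ 2 + 2 * ϖ z.1 z.2) * ⟪v z.1 z.2, gradient ψ z.2⟫‖ₑ
      ≤ ∫⁻ z in S, (ENNReal.ofReal MΔ * ‖v z.1 z.2‖ₑ ^ 2 +
          3 * ENNReal.ofReal Mg * ‖v z.1 z.2‖ₑ ^ (3 : ℕ) +
          2 * ENNReal.ofReal Mg * ‖ϖ z.1 z.2‖ₑ ^ (3 / 2 : ℝ)) := lintegral_mono hpt
    _ = ENNReal.ofReal MΔ * (∫⁻ z in S, ‖v z.1 z.2‖ₑ ^ 2) +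
          3 * ENNReal.ofReal Mg * (∫⁻ z in S, ‖v z.1 z.2‖ₑ ^ (3 : ℕ)) +
          2 * ENNReal.ofReal Mg * ∫⁻ z in S, ‖ϖ z.1 z.2‖ₑ ^ (3 / 2 : ℝ) := by
        rw [lintegral_add_left' hAB, lintegral_add_left' hA,
          lintegral_const_mul' _ _ ENNReal.ofReal_ne_top, lintegral_const_mul' _ _ h3top,
          lintegral_const_mul' _ _ h2top]

/-! ## The cubic term on a slice: Gagliardo–Nirenberg and Young -/

/-- **The cubic term on one slice** (Bradshaw–Tsai 2019, (3.11) and "the gradient term can be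
absorbed into the left hand side of (3.7)", p. 9): if `∫_{B₁}|f|³ ≤ C_G a^{3/4}(a^{3/4} + g₂^{3/4})`
with `a = ∫_{B₁}|f|²`, `g₂ = ∫_{B₁}|g|²` (the slice interpolation for a weak derivative `g` of `f`
on `B₁`), and `a ≤ c' E`, then for every finite coefficient `Λ`,
`Λ ∫_{B₁}|f|³ ≤ g₂ + (Λ C_G c'^{3/2} + (Λ C_G)⁴ c'³)(E³ + E)`
(Young `Λ C_G a^{3/4} g₂^{3/4} ≤ g₂ + (ΛC_G)⁴a³`, `a^{3/2} ≤ (c'E)^{3/2} ≤ c'^{3/2}(E + E³)`,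
`a³ ≤ c'³E³`). [cite: BradshawTsai2019, §3 proof of Prop 3.1 ((3.11) and the absorption, p. 9)] -/
theorem slice_cube_le {j a g₂ c' E Λ : ℝ≥0∞} {CG : ℝ≥0} (hΛ : Λ ≠ ⊤)
    (hGN : j ≤ CG * a ^ (3 / 4 : ℝ) * (a ^ (3 / 4 : ℝ) + g₂ ^ (3 / 4 : ℝ))) (haE : a ≤ c' * E) :
    Λ * j ≤ g₂ + (Λ * CG * c' ^ (3 / 2 : ℝ) + ENNReal.ofReal ((Λ * CG).toReal ^ 4) * c' ^ 3) *
      (E ^ 3 + E) := by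
  -- the Young constant
  set C : ℝ := (Λ * CG).toReal with hC
  have hC0 : 0 ≤ C := ENNReal.toReal_nonneg
  have hCeq : ENNReal.ofReal C = Λ * CG :=
    ENNReal.ofReal_toReal (ENNReal.mul_ne_top hΛ ENNReal.coe_ne_top)
  -- `Λ j ≤ ΛC_G a^{3/2} + ΛC_G a^{3/4} g₂^{3/4}`
  have h32 : a ^ (3 / 4 : ℝ) * a ^ (3 / 4 : ℝ) = a ^ (3 / 2 : ℝ) := by
    rw [← ENNReal.rpow_add_of_nonneg _ _ (by norm_num : (0 : ℝ) ≤ 3 / 4)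
      (by norm_num : (0 : ℝ) ≤ 3 / 4)]
    norm_num
  have h1 : Λ * j ≤ Λ * CG * a ^ (3 / 2 : ℝ) + ENNReal.ofReal C * a ^ (3 / 4 : ℝ) * g₂ ^ (3 / 4 : ℝ) := by
    calc Λ * j ≤ Λ * (CG * a ^ (3 / 4 : ℝ) * (a ^ (3 / 4 : ℝ) + g₂ ^ (3 / 4 : ℝ))) :=
          mul_le_mul' le_rfl hGN
      _ = Λ * CG * a ^ (3 / 2 : ℝ) + Λ * CG * a ^ (3 / 4 : ℝ) * g₂ ^ (3 / 4 : ℝ) := by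
          rw [← h32]; ring
      _ = Λ * CG * a ^ (3 / 2 : ℝ) + ENNReal.ofReal C * a ^ (3 / 4 : ℝ) * g₂ ^ (3 / 4 : ℝ) := by
          rw [hCeq]
  -- Young with `η = 1`
  have hY : ENNReal.ofReal C * a ^ (3 / 4 : ℝ) * g₂ ^ (3 / 4 : ℝ) ≤
      g₂ + ENNReal.ofReal (C ^ 4) * a ^ 3 := by
    have h := young_three_quarters (a := a) (b := g₂) hC0 one_pos
    rwa [ENNReal.ofReal_one, one_mul, inv_one, one_pow, mul_one] at h
  -- `t^{3/2} ≤ t + t³` ("`α^{3/2} ≤ α + α³`", p. 10)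
  have h32le : ∀ t : ℝ≥0∞, t ^ (3 / 2 : ℝ) ≤ t + t ^ 3 := by
    intro t
    rcases le_or_gt t 1 with ht | ht
    · calc t ^ (3 / 2 : ℝ) ≤ t ^ (1 : ℝ) := ENNReal.rpow_le_rpow_of_exponent_ge ht (by norm_num)
        _ = t := ENNReal.rpow_one t
        _ ≤ t + t ^ 3 := le_self_add
    · calc t ^ (3 / 2 : ℝ) ≤ t ^ (3 : ℝ) := ENNReal.rpow_le_rpow_of_exponent_le ht.le (by norm_num)
        _ = t ^ 3 := by rw [show (3 : ℝ) = ((3 : ℕ) : ℝ) by norm_num, ENNReal.rpow_natCast]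
        _ ≤ t + t ^ 3 := le_add_self
  -- `a ≤ c'E`
  have ha32 : a ^ (3 / 2 : ℝ) ≤ c' ^ (3 / 2 : ℝ) * (E ^ 3 + E) := by
    calc a ^ (3 / 2 : ℝ) ≤ (c' * E) ^ (3 / 2 : ℝ) := ENNReal.rpow_le_rpow haE (by norm_num)
      _ = c' ^ (3 / 2 : ℝ) * E ^ (3 / 2 : ℝ) := ENNReal.mul_rpow_of_nonneg _ _ (by norm_num)
      _ ≤ c' ^ (3 / 2 : ℝ) * (E ^ 3 + E) := by
          refine mul_le_mul' le_rfl ?_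
          rw [add_comm]
          exact h32le E
  have ha3 : a ^ 3 ≤ c' ^ 3 * (E ^ 3 + E) := by
    calc a ^ 3 ≤ (c' * E) ^ 3 := pow_le_pow_left' haE 3
      _ = c' ^ 3 * E ^ 3 := mul_pow _ _ _
      _ ≤ c' ^ 3 * (E ^ 3 + E) := mul_le_mul' le_rfl le_self_add
  calc Λ * j ≤ Λ * CG * a ^ (3 / 2 : ℝ) + ENNReal.ofReal C * a ^ (3 / 4 : ℝ) * g₂ ^ (3 / 4 : ℝ) := h1
    _ ≤ Λ * CG * (c' ^ (3 / 2 : ℝ) * (E ^ 3 + E)) + (g₂ + ENNReal.ofReal (C ^ 4) * a ^ 3) :=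
        add_le_add (mul_le_mul' le_rfl ha32) hY
    _ ≤ Λ * CG * (c' ^ (3 / 2 : ℝ) * (E ^ 3 + E)) +
          (g₂ + ENNReal.ofReal (C ^ 4) * (c' ^ 3 * (E ^ 3 + E))) := by
        gcongr
    _ = g₂ + (Λ * CG * c' ^ (3 / 2 : ℝ) + ENNReal.ofReal (C ^ 4) * c' ^ 3) * (E ^ 3 + E) := by
        ring

/-! ## The a priori estimate (3.12) for every DSS local Leray solution -/

/-- **Bradshaw–Tsai 2019, (3.12) and the pressure bound of p. 10, for every `λ`-DSS local Leray
solution** (arXiv:1801.08060, Prop. 3.1 and its proof, pp. 8–10, run on the local energy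
inequality of Kang–Miura–Tsai's class instead of the mollified approximants). Fix `λ > 1` (and
Stein's bound **CZ**). There is `K = K(λ) < ∞` such that: for every local Leray solution
`(v, ϖ)` (`ν = 1`) with measurable datum `v₀`, `v` `λ`-DSS, every weak spatial gradient `G` of
`v` on the slab `(0,∞) × ℝ³` with `∫∫_{(0,1)×B₁}|G|² < ∞`, if `ϖ` is gauged on `B_λ`
(`ϖ = π_loc + π_far` a.e. on `(0,1) × B_λ`), then, with `α(s) = ∫_{B₁}|v(s)|²` and
`α̃(σ) = esssup_{0<τ<σ} α(τ)`:
(i) for a.e. `s ∈ (0,1)`,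
`α(s) + ∫∫_{(0,s)×B₁}|G|² ≤ ∫_{B_λ}|v₀|² + K ∫₀ˢ (α̃(σ)³ + α̃(σ)) dσ` — the printed (3.12)
"`α_ε(t) + ∫₀ᵗ∫_{B₁}|∇v_ε|² dx ds ≤ α₀ + C ∫₀ᵗ (α̃_ε(s)³ + α̃_ε(s)) ds`";
(ii) for every `s ∈ (0,1]`,
`∫∫_{(0,s)×B_λ}|ϖ|^{3/2} ≤ K (∫∫_{(0,s)×B₁}|G|² + ∫₀ˢ (α̃³ + α̃))` — the bound
"`∫₀ᵗ‖π_ε‖^{3/2}_{L^{3/2}(B_λ)} ≤ C∫₀ᵗ(α̃³_ε + α̃_ε) + γ∫₀ᵗ∫|∇v_ε|²φ`" of p. 10.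
See the module docstring for the proof. [cite: BradshawTsai2019, Prop 3.1 (proof pp. 8–10: (3.6), (3.7), (3.11), (3.12), pressure bounds p. 10)] -/
theorem exists_apriori_ae (hCZ : stein1970_normalisedPressure_ae_Lp_bound) {c : ℝ} (hc : 1 < c) :
    ∃ K : ℝ≥0∞, K ≠ ⊤ ∧
      ∀ {v₀ : EuclideanSpace ℝ (Fin 3) → EuclideanSpace ℝ (Fin 3)} {v : ℝ → EuclideanSpace ℝ (Fin 3) → EuclideanSpace ℝ (Fin 3)} {ϖ : ℝ → EuclideanSpace ℝ (Fin 3) → ℝ}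
        {G : ℝ → EuclideanSpace ℝ (Fin 3) → EuclideanSpace ℝ (Fin 3) →L[ℝ] EuclideanSpace ℝ (Fin 3)},
        AEStronglyMeasurable v₀ volume → IsLocalLeraySolution 1 v₀ v ϖ →
        IsDiscretelySelfSimilar c v →
        HasWeakSpatialGradientOn (slab (EuclideanSpace ℝ (Fin 3)) (Ioi 0) isOpen_Ioi) v G →
        (∀ᵐ z ∂(volume.restrict (Ioo 0 1 ×ˢ ball (0 : EuclideanSpace ℝ (Fin 3)) c)),
          ϖ z.1 z.2 = localPressureNear 0 c v z.1 z.2 + localPressureFar 0 c v z.1 z.2) →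
        (∫⁻ z in Ioo 0 1 ×ˢ ball (0 : EuclideanSpace ℝ (Fin 3)) 1, ENNReal.ofReal (frobeniusNormSq (G z.1 z.2))) ≠ ⊤ →
        (∀ᵐ s ∂(volume.restrict (Ioo (0 : ℝ) 1)),
          ballEnergy v s + (∫⁻ z in Ioo 0 s ×ˢ ball (0 : EuclideanSpace ℝ (Fin 3)) 1, ENNReal.ofReal (frobeniusNormSq (G z.1 z.2))) ≤
            (∫⁻ x in ball (0 : EuclideanSpace ℝ (Fin 3)) c, ‖v₀ x‖ₑ ^ 2) + K * (∫⁻ σ in Ioo 0 s, (essSup (ballEnergy v) (volume.restrict (Ioo 0 σ)) ^ 3 + essSup (ballEnergy v) (volume.restrict (Ioo 0 σ))))) ∧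
        (∀ s ∈ Ioc (0 : ℝ) 1,
          (∫⁻ z in Ioo 0 s ×ˢ ball (0 : EuclideanSpace ℝ (Fin 3)) c, ‖ϖ z.1 z.2‖ₑ ^ (3 / 2 : ℝ)) ≤ K * ((∫⁻ z in Ioo 0 s ×ˢ ball (0 : EuclideanSpace ℝ (Fin 3)) 1, ENNReal.ofReal (frobeniusNormSq (G z.1 z.2))) + (∫⁻ σ in Ioo 0 s, (essSup (ballEnergy v) (volume.restrict (Ioo 0 σ)) ^ 3 + essSup (ballEnergy v) (volume.restrict (Ioo 0 σ)))))) := by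
  have hc0 : 0 < c := zero_lt_one.trans hc
  have hc'top : ENNReal.ofReal c ≠ ⊤ := ENNReal.ofReal_ne_top
  -- ### the constants
  obtain ⟨ψ, hψs, hψcs, hψ0, hψ1, hψB, hts, Mg, MΔ, hMg0, hMΔ0, hMg, hMΔ⟩ := exists_unit_cutoff hc
  obtain ⟨Cp, hCptop, hP⟩ := exists_gaugedPressure_cylinder_le hCZ hc hc0
  obtain ⟨CG, hCG1, hGN⟩ := exists_lintegral_ball_cube_le
  obtain ⟨m', hm'⟩ : ∃ m' : ℕ, 2 * c ≤ c ^ m' :=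
    (pow_unbounded_of_one_lt (2 * c) hc).imp fun _ h => h.le
  have hcm1 : 1 < c ^ m' := lt_of_lt_of_le (by linarith) hm'
  -- finiteness of the generic Young coefficient
  have hLtop : ∀ {Λ : ℝ≥0∞}, Λ ≠ ⊤ → (Λ * CG * ENNReal.ofReal c ^ (3 / 2 : ℝ) + ENNReal.ofReal ((Λ * CG).toReal ^ 4) * ENNReal.ofReal c ^ 3) ≠ ⊤ := fun hΛ =>
    ENNReal.add_ne_top.2 ⟨ENNReal.mul_ne_top (ENNReal.mul_ne_top hΛ ENNReal.coe_ne_top)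
      (ENNReal.rpow_ne_top_of_nonneg (by norm_num) hc'top),
      ENNReal.mul_ne_top ENNReal.ofReal_ne_top (ENNReal.pow_ne_top hc'top)⟩
  obtain ⟨Kc, hKc⟩ : ∃ Kc : ℝ≥0∞, Kc = 3 * ENNReal.ofReal Mg * ENNReal.ofReal (c ^ 2) +
      2 * ENNReal.ofReal Mg * Cp * ENNReal.ofReal ((c ^ m') ^ 2) := ⟨_, rfl⟩
  have hKctop : Kc ≠ ⊤ := by
    rw [hKc]
    exact ENNReal.add_ne_top.2 ⟨ENNReal.mul_ne_top (ENNReal.mul_ne_top (by norm_num)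
      ENNReal.ofReal_ne_top) ENNReal.ofReal_ne_top, ENNReal.mul_ne_top (ENNReal.mul_ne_top
      (ENNReal.mul_ne_top (by norm_num) ENNReal.ofReal_ne_top) hCptop) ENNReal.ofReal_ne_top⟩
  obtain ⟨Λ', hΛ'⟩ : ∃ Λ' : ℝ≥0∞, Λ' = Cp * ENNReal.ofReal ((c ^ m') ^ 2) := ⟨_, rfl⟩
  have hΛ'top : Λ' ≠ ⊤ := by rw [hΛ']; exact ENNReal.mul_ne_top hCptop ENNReal.ofReal_ne_top
  obtain ⟨KA, hKA⟩ : ∃ KA : ℝ≥0∞, KA = ENNReal.ofReal MΔ * ENNReal.ofReal c + (Kc * CG * ENNReal.ofReal c ^ (3 / 2 : ℝ) + ENNReal.ofReal ((Kc * CG).toReal ^ 4) * ENNReal.ofReal c ^ 3) +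
      2 * ENNReal.ofReal Mg * Cp := ⟨_, rfl⟩
  obtain ⟨KB, hKB⟩ : ∃ KB : ℝ≥0∞, KB = 1 + (Λ' * CG * ENNReal.ofReal c ^ (3 / 2 : ℝ) + ENNReal.ofReal ((Λ' * CG).toReal ^ 4) * ENNReal.ofReal c ^ 3) + Cp := ⟨_, rfl⟩
  have hKAtop : KA ≠ ⊤ := by
    rw [hKA]
    exact ENNReal.add_ne_top.2 ⟨ENNReal.add_ne_top.2 ⟨ENNReal.mul_ne_top ENNReal.ofReal_ne_top
      hc'top, hLtop hKctop⟩, ENNReal.mul_ne_top (ENNReal.mul_ne_top (by norm_num)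
      ENNReal.ofReal_ne_top) hCptop⟩
  have hKBtop : KB ≠ ⊤ := by
    rw [hKB]
    exact ENNReal.add_ne_top.2 ⟨ENNReal.add_ne_top.2 ⟨ENNReal.one_ne_top, hLtop hΛ'top⟩, hCptop⟩
  refine ⟨KA + KB, ENNReal.add_ne_top.2 ⟨hKAtop, hKBtop⟩, ?_⟩
  intro v₀ v ϖ G hm₀ hv hdss hG hdec hDfin
  -- ### measurability on boxes, Tonelli
  have hvm : AEStronglyMeasurable (uncurry v)
      (volume.restrict (Ioi (0 : ℝ) ×ˢ (univ : Set (EuclideanSpace ℝ (Fin 3))))) := hv.aestronglyMeasurable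
  have hGm : AEStronglyMeasurable (uncurry G)
      (volume.restrict (Ioi (0 : ℝ) ×ˢ (univ : Set (EuclideanSpace ℝ (Fin 3))))) :=
    hG.locallyIntegrableOn_grad.aestronglyMeasurable
  have hbox : ∀ (s : ℝ) (S : Set (EuclideanSpace ℝ (Fin 3))),
      (volume.restrict (Ioo 0 s)).prod (volume.restrict S) = volume.restrict (Ioo 0 s ×ˢ S) :=
    fun s S => by rw [Measure.prod_restrict, ← Measure.volume_eq_prod]
  have hsub : ∀ (s : ℝ) (S : Set (EuclideanSpace ℝ (Fin 3))),
      Ioo 0 s ×ˢ S ⊆ Ioi (0 : ℝ) ×ˢ (univ : Set (EuclideanSpace ℝ (Fin 3))) := fun s S =>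
    Set.prod_mono Ioo_subset_Ioi_self (subset_univ _)
  have hvmS : ∀ (s : ℝ) (S : Set (EuclideanSpace ℝ (Fin 3))),
      AEStronglyMeasurable (uncurry v) ((volume.restrict (Ioo 0 s)).prod (volume.restrict S)) :=
    fun s S => by
      rw [hbox]
      exact hvm.mono_measure (Measure.restrict_mono (hsub s S) le_rfl)
  have hGmS : ∀ (s : ℝ) (S : Set (EuclideanSpace ℝ (Fin 3))),
      AEStronglyMeasurable (uncurry G) ((volume.restrict (Ioo 0 s)).prod (volume.restrict S)) :=
    fun s S => by
      rw [hbox]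
      exact hGm.mono_measure (Measure.restrict_mono (hsub s S) le_rfl)
  have hFm : ∀ s : ℝ, AEMeasurable
      (fun z : ℝ × EuclideanSpace ℝ (Fin 3) => ENNReal.ofReal (frobeniusNormSq (G z.1 z.2)))
      ((volume.restrict (Ioo 0 s)).prod (volume.restrict (ball (0 : EuclideanSpace ℝ (Fin 3)) 1))) := fun s =>
    ENNReal.measurable_ofReal.comp_aemeasurable
      (continuous_frobeniusNormSq'.measurable.comp_aemeasurable (hGmS s _).aemeasurable)
  have hV3m : ∀ s : ℝ, AEMeasurable (fun z : ℝ × EuclideanSpace ℝ (Fin 3) => ‖v z.1 z.2‖ₑ ^ (3 : ℕ))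
      ((volume.restrict (Ioo 0 s)).prod (volume.restrict (ball (0 : EuclideanSpace ℝ (Fin 3)) 1))) := fun s =>
    (hvmS s _).enorm.pow_const 3
  have hDe : ∀ s : ℝ, (∫⁻ z in Ioo 0 s ×ˢ ball (0 : EuclideanSpace ℝ (Fin 3)) 1, ENNReal.ofReal (frobeniusNormSq (G z.1 z.2))) = ∫⁻ σ in Ioo 0 s, (∫⁻ x in ball (0 : EuclideanSpace ℝ (Fin 3)) 1, ENNReal.ofReal (frobeniusNormSq (G σ x))) := fun s => by
    rw [← hbox, lintegral_prod _ (hFm s)]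
  have hJj : ∀ s : ℝ, (∫⁻ z in Ioo 0 s ×ˢ ball (0 : EuclideanSpace ℝ (Fin 3)) 1, ‖v z.1 z.2‖ₑ ^ (3 : ℕ)) = ∫⁻ σ in Ioo 0 s, (∫⁻ x in ball (0 : EuclideanSpace ℝ (Fin 3)) 1, ‖v σ x‖ₑ ^ (3 : ℕ)) := fun s => by
    rw [← hbox, lintegral_prod _ (hV3m s)]
  have hem : ∀ s : ℝ, AEMeasurable (fun σ : ℝ => (∫⁻ x in ball (0 : EuclideanSpace ℝ (Fin 3)) 1, ENNReal.ofReal (frobeniusNormSq (G σ x)))) (volume.restrict (Ioo 0 s)) :=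
    fun s => (hFm s).lintegral_prod_right'
  -- ### the slice facts, a.e. in time
  have hmE : ∀ᵐ σ ∂(volume : Measure ℝ), 0 < σ → ∀ i : ℕ,
      ballEnergy v (((c ^ (i + 1)) ^ 2)⁻¹ * σ) ≤ essSup (ballEnergy v) (volume.restrict (Ioo 0 σ)) :=
    ae_forall_mul_le_essSup_Ioo (ballEnergy v) (κ := fun i : ℕ => ((c ^ (i + 1)) ^ 2)⁻¹)
      (fun i => by positivity)
      (fun i => inv_lt_one_of_one_lt₀ (one_lt_pow₀ (one_lt_pow₀ hc (Nat.succ_ne_zero i))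
        two_ne_zero))
  have hmET : ∀ T : ℝ, ∀ᵐ σ ∂(volume.restrict (Ioo 0 T)), ∀ i : ℕ,
      ballEnergy v (((c ^ (i + 1)) ^ 2)⁻¹ * σ) ≤ essSup (ballEnergy v) (volume.restrict (Ioo 0 σ)) := fun T => by
    filter_upwards [ae_restrict_of_ae (μ := volume) (s := Ioo 0 T) hmE,
      ae_restrict_mem measurableSet_Ioo] with σ hσ hσI
    exact hσ hσI.1
  have hαE : ∀ T : ℝ, ∀ᵐ σ ∂(volume.restrict (Ioo 0 T)),
      ballEnergy v σ ≤ ENNReal.ofReal c * essSup (ballEnergy v) (volume.restrict (Ioo 0 σ)) := fun T => by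
    filter_upwards [hmET T] with σ hσ
    calc ballEnergy v σ ≤ ∫⁻ x in ball (0 : EuclideanSpace ℝ (Fin 3)) c, ‖v σ x‖ₑ ^ 2 :=
          lintegral_mono_set (ball_subset_ball hc.le)
      _ = ENNReal.ofReal c * ballEnergy v ((c ^ 2)⁻¹ * σ) :=
          setLIntegral_ball_enorm_sq_eq_ballEnergy hc0 hdss σ
      _ ≤ ENNReal.ofReal c * essSup (ballEnergy v) (volume.restrict (Ioo 0 σ)) := by
          refine mul_le_mul' le_rfl ?_
          have h := hσ 0
          rwa [zero_add, pow_one] at h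
  have hslice : ∀ᵐ σ ∂(volume.restrict (Ioo (0 : ℝ) 1)),
      FunctionSpaces.HasWeakFDerivOn (⟨ball (0 : EuclideanSpace ℝ (Fin 3)) 1, isOpen_ball⟩ : Opens (EuclideanSpace ℝ (Fin 3)))
        volume (v σ) (G σ) := by
    have hle : (slab (EuclideanSpace ℝ (Fin 3)) (Ioo 0 1) isOpen_Ioo : Opens (ℝ × EuclideanSpace ℝ (Fin 3))) ≤
        slab (EuclideanSpace ℝ (Fin 3)) (Ioi 0) isOpen_Ioi := fun z hz => mem_slab.2 (mem_slab.1 hz).1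
    have h1 := hG.mono hle
    rw [slab_eq_prod_top] at h1
    filter_upwards [h1.ae_hasWeakFDerivOn_slice] with σ hσ
    exact FunctionSpaces.HasWeakFDerivOn.mono_set_holds hσ le_top
  -- `t^{3/2} ≤ t + t³` ("`α^{3/2} ≤ α + α³`", p. 10)
  have h32le : ∀ t : ℝ≥0∞, t ^ (3 / 2 : ℝ) ≤ t + t ^ 3 := by
    intro t
    rcases le_or_gt t 1 with ht | ht
    · calc t ^ (3 / 2 : ℝ) ≤ t ^ (1 : ℝ) := ENNReal.rpow_le_rpow_of_exponent_ge ht (by norm_num)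
        _ = t := ENNReal.rpow_one t
        _ ≤ t + t ^ 3 := le_self_add
    · calc t ^ (3 / 2 : ℝ) ≤ t ^ (3 : ℝ) := ENNReal.rpow_le_rpow_of_exponent_le ht.le (by norm_num)
        _ = t ^ 3 := by rw [show (3 : ℝ) = ((3 : ℕ) : ℝ) by norm_num, ENNReal.rpow_natCast]
        _ ≤ t + t ^ 3 := le_add_self
  have hE1 : ∀ s : ℝ, (∫⁻ σ in Ioo 0 s, essSup (ballEnergy v) (volume.restrict (Ioo 0 σ))) ≤ (∫⁻ σ in Ioo 0 s, (essSup (ballEnergy v) (volume.restrict (Ioo 0 σ)) ^ 3 + essSup (ballEnergy v) (volume.restrict (Ioo 0 σ)))) := fun s =>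
    lintegral_mono fun σ => le_add_self
  have hE32 : ∀ s : ℝ, (∫⁻ σ in Ioo 0 s, essSup (ballEnergy v) (volume.restrict (Ioo 0 σ)) ^ (3 / 2 : ℝ)) ≤ (∫⁻ σ in Ioo 0 s, (essSup (ballEnergy v) (volume.restrict (Ioo 0 σ)) ^ 3 + essSup (ballEnergy v) (volume.restrict (Ioo 0 σ)))) := fun s =>
    lintegral_mono fun σ => (h32le _).trans_eq (add_comm _ _)
  -- ### the cubic term: slice-wise (3.11) + Young, then integrated
  have hcube : ∀ {Λ : ℝ≥0∞}, Λ ≠ ⊤ → ∀ᵐ σ ∂(volume.restrict (Ioo (0 : ℝ) 1)),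
      Λ * (∫⁻ x in ball (0 : EuclideanSpace ℝ (Fin 3)) 1, ‖v σ x‖ₑ ^ (3 : ℕ)) ≤ (∫⁻ x in ball (0 : EuclideanSpace ℝ (Fin 3)) 1, ENNReal.ofReal (frobeniusNormSq (G σ x))) + (Λ * CG * ENNReal.ofReal c ^ (3 / 2 : ℝ) + ENNReal.ofReal ((Λ * CG).toReal ^ 4) * ENNReal.ofReal c ^ 3) * (essSup (ballEnergy v) (volume.restrict (Ioo 0 σ)) ^ 3 + essSup (ballEnergy v) (volume.restrict (Ioo 0 σ))) := by
    intro Λ hΛ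
    filter_upwards [hslice, hαE 1] with σ hσ hσE
    exact slice_cube_le hΛ (hGN 0 (v σ) (G σ) hσ) hσE
  have hΛJ : ∀ {Λ : ℝ≥0∞}, Λ ≠ ⊤ → ∀ s : ℝ, s ≤ 1 →
      Λ * (∫⁻ z in Ioo 0 s ×ˢ ball (0 : EuclideanSpace ℝ (Fin 3)) 1, ‖v z.1 z.2‖ₑ ^ (3 : ℕ)) ≤ (∫⁻ z in Ioo 0 s ×ˢ ball (0 : EuclideanSpace ℝ (Fin 3)) 1, ENNReal.ofReal (frobeniusNormSq (G z.1 z.2))) + (Λ * CG * ENNReal.ofReal c ^ (3 / 2 : ℝ) + ENNReal.ofReal ((Λ * CG).toReal ^ 4) * ENNReal.ofReal c ^ 3) * (∫⁻ σ in Ioo 0 s, (essSup (ballEnergy v) (volume.restrict (Ioo 0 σ)) ^ 3 + essSup (ballEnergy v) (volume.restrict (Ioo 0 σ)))) := by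
    intro Λ hΛ s hs1
    rw [hJj s, hDe s]
    calc Λ * (∫⁻ σ in Ioo 0 s, (∫⁻ x in ball (0 : EuclideanSpace ℝ (Fin 3)) 1, ‖v σ x‖ₑ ^ (3 : ℕ))) = ∫⁻ σ in Ioo 0 s, Λ * (∫⁻ x in ball (0 : EuclideanSpace ℝ (Fin 3)) 1, ‖v σ x‖ₑ ^ (3 : ℕ)) :=
          (lintegral_const_mul' _ _ hΛ).symm
      _ ≤ ∫⁻ σ in Ioo 0 s, ((∫⁻ x in ball (0 : EuclideanSpace ℝ (Fin 3)) 1, ENNReal.ofReal (frobeniusNormSq (G σ x))) + (Λ * CG * ENNReal.ofReal c ^ (3 / 2 : ℝ) + ENNReal.ofReal ((Λ * CG).toReal ^ 4) * ENNReal.ofReal c ^ 3) * (essSup (ballEnergy v) (volume.restrict (Ioo 0 σ)) ^ 3 + essSup (ballEnergy v) (volume.restrict (Ioo 0 σ)))) :=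
          lintegral_mono_ae (ae_restrict_of_ae_restrict_of_subset (Ioo_subset_Ioo_right hs1)
            (hcube hΛ))
      _ = (∫⁻ σ in Ioo 0 s, (∫⁻ x in ball (0 : EuclideanSpace ℝ (Fin 3)) 1, ENNReal.ofReal (frobeniusNormSq (G σ x)))) + (Λ * CG * ENNReal.ofReal c ^ (3 / 2 : ℝ) + ENNReal.ofReal ((Λ * CG).toReal ^ 4) * ENNReal.ofReal c ^ 3) * (∫⁻ σ in Ioo 0 s, (essSup (ballEnergy v) (volume.restrict (Ioo 0 σ)) ^ 3 + essSup (ballEnergy v) (volume.restrict (Ioo 0 σ)))) := by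
          rw [lintegral_add_left' (hem s), lintegral_const_mul' _ _ (hLtop hΛ)]
  -- ### the cube integrals on `B_λ`, `B_{2λ}` by the scaling law (3.6)
  have h3 : ∀ x : ℝ≥0∞, x ^ (3 : ℝ) = x ^ (3 : ℕ) := fun x => by
    rw [show (3 : ℝ) = ((3 : ℕ) : ℝ) by norm_num, ENNReal.rpow_natCast]
  have hI3 : ∀ s : ℝ, 0 < s → (∫⁻ z in Ioo 0 s ×ˢ ball (0 : EuclideanSpace ℝ (Fin 3)) c, ‖v z.1 z.2‖ₑ ^ (3 : ℕ)) ≤ ENNReal.ofReal (c ^ 2) * (∫⁻ z in Ioo 0 s ×ˢ ball (0 : EuclideanSpace ℝ (Fin 3)) 1, ‖v z.1 z.2‖ₑ ^ (3 : ℕ)) := by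
    intro s hs0
    have h := setLIntegral_cylinder_enorm_cube_le_of_dss hc hdss hs0
    simp only [h3] at h
    exact h
  have hG3 : ∀ s : ℝ, 0 < s → (∫⁻ z in Ioo 0 s ×ˢ ball (0 : EuclideanSpace ℝ (Fin 3)) (2 * c), ‖v z.1 z.2‖ₑ ^ (3 : ℕ)) ≤ ENNReal.ofReal ((c ^ m') ^ 2) * (∫⁻ z in Ioo 0 s ×ˢ ball (0 : EuclideanSpace ℝ (Fin 3)) 1, ‖v z.1 z.2‖ₑ ^ (3 : ℕ)) := by
    intro s hs0
    have h := setLIntegral_cylinder_enorm_cube_le_of_dss hcm1 (isDiscretelySelfSimilar_pow hdss m')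
      hs0
    simp only [h3] at h
    exact (lintegral_mono_set (Set.prod_mono Subset.rfl (ball_subset_ball hm'))).trans h
  -- ### the gauged pressure on `(0,s) × B_λ`
  have hPs : ∀ s : ℝ, s ≤ 1 → (∫⁻ z in Ioo 0 s ×ˢ ball (0 : EuclideanSpace ℝ (Fin 3)) c, ‖ϖ z.1 z.2‖ₑ ^ (3 / 2 : ℝ)) ≤
      Cp * (∫⁻ z in Ioo 0 s ×ˢ ball (0 : EuclideanSpace ℝ (Fin 3)) (2 * c), ‖v z.1 z.2‖ₑ ^ (3 : ℕ)) + Cp * (∫⁻ σ in Ioo 0 s, essSup (ballEnergy v) (volume.restrict (Ioo 0 σ)) ^ (3 / 2 : ℝ)) := by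
    intro s hs1
    have hdecs : ∀ᵐ z ∂(volume.restrict (Ioo 0 s ×ˢ ball (0 : EuclideanSpace ℝ (Fin 3)) c)),
        ϖ z.1 z.2 = localPressureNear 0 c v z.1 z.2 + localPressureFar 0 c v z.1 z.2 :=
      ae_restrict_of_ae_restrict_of_subset (Set.prod_mono (Ioo_subset_Ioo_right hs1) Subset.rfl) hdec
    exact hP hv hdss (T := s) (m := fun σ => essSup (ballEnergy v) (volume.restrict (Ioo 0 σ))) hdecs (hmET s)
  refine ⟨?_, ?_⟩
  · -- ### (i): (3.12) at a.e. `s ∈ (0,1)`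
    have hu3 : IntegrableOn (fun z : ℝ × EuclideanSpace ℝ (Fin 3) => ‖v z.1 z.2‖ ^ 3)
        (Ioo 0 2 ×ˢ ball (0 : EuclideanSpace ℝ (Fin 3)) c) volume :=
      (hv.integrableOn_cube_block_zero two_pos (isCompact_closedBall 0 c)).mono_set
        (Set.prod_mono Subset.rfl ball_subset_closedBall)
    have hLEI := hv.ae_lintegral_sq_mul_add_grad_le_datum_add hm₀ hG two_pos hu3 hψs hts hψ0
    rw [show (2 : ℝ) / 2 = 1 by norm_num] at hLEI
    filter_upwards [hLEI, ae_restrict_mem measurableSet_Ioo] with s hs hsI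
    have hs0 : 0 < s := hsI.1
    have hs1 : s ≤ 1 := hsI.2.le
    -- the left-hand side dominates `α(s) + 2∫∫_{(0,s)×B₁}|G|²`
    have hαψ : ballEnergy v s ≤ ∫⁻ x, ‖v s x‖ₑ ^ 2 * ENNReal.ofReal (ψ x) := by
      calc ballEnergy v s = ∫⁻ x in ball (0 : EuclideanSpace ℝ (Fin 3)) 1, ‖v s x‖ₑ ^ 2 * ENNReal.ofReal (ψ x) :=
            setLIntegral_congr_fun measurableSet_ball fun x hx => by
              rw [hψB x hx, ENNReal.ofReal_one, mul_one]
        _ ≤ _ := setLIntegral_le_lintegral _ _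
    have hDψ : (∫⁻ z in Ioo 0 s ×ˢ ball (0 : EuclideanSpace ℝ (Fin 3)) 1, ENNReal.ofReal (frobeniusNormSq (G z.1 z.2))) ≤
        ∫⁻ z in Ioo 0 s ×ˢ ball (0 : EuclideanSpace ℝ (Fin 3)) c,
          ENNReal.ofReal (frobeniusNormSq (G z.1 z.2)) * ENNReal.ofReal (ψ z.2) := by
      calc (∫⁻ z in Ioo 0 s ×ˢ ball (0 : EuclideanSpace ℝ (Fin 3)) 1, ENNReal.ofReal (frobeniusNormSq (G z.1 z.2)))
          = ∫⁻ z in Ioo 0 s ×ˢ ball (0 : EuclideanSpace ℝ (Fin 3)) 1,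
              ENNReal.ofReal (frobeniusNormSq (G z.1 z.2)) * ENNReal.ofReal (ψ z.2) :=
            setLIntegral_congr_fun (measurableSet_Ioo.prod measurableSet_ball) fun z hz => by
              rw [hψB z.2 hz.2, ENNReal.ofReal_one, mul_one]
        _ ≤ _ := lintegral_mono_set (Set.prod_mono Subset.rfl (ball_subset_ball hc.le))
    -- the datum term is at most `∫_{B_λ}|v₀|²`
    have hψout : ∀ x, x ∉ ball (0 : EuclideanSpace ℝ (Fin 3)) c → ψ x = 0 := fun x hx =>
      image_eq_zero_of_notMem_tsupport fun h => hx (hts h)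
    have hdat : ∫⁻ x, ‖v₀ x‖ₑ ^ 2 * ENNReal.ofReal (ψ x) ≤ ∫⁻ x in ball (0 : EuclideanSpace ℝ (Fin 3)) c, ‖v₀ x‖ₑ ^ 2 := by
      calc ∫⁻ x, ‖v₀ x‖ₑ ^ 2 * ENNReal.ofReal (ψ x)
          = ∫⁻ x, (ball (0 : EuclideanSpace ℝ (Fin 3)) c).indicator
              (fun x => ‖v₀ x‖ₑ ^ 2 * ENNReal.ofReal (ψ x)) x := by
            refine lintegral_congr fun x => ?_
            by_cases hx : x ∈ ball (0 : EuclideanSpace ℝ (Fin 3)) c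
            · rw [indicator_of_mem hx]
            · rw [indicator_of_notMem hx, hψout x hx, ENNReal.ofReal_zero, mul_zero]
        _ = ∫⁻ x in ball (0 : EuclideanSpace ℝ (Fin 3)) c, ‖v₀ x‖ₑ ^ 2 * ENNReal.ofReal (ψ x) :=
            lintegral_indicator measurableSet_ball _
        _ ≤ ∫⁻ x in ball (0 : EuclideanSpace ℝ (Fin 3)) c, ‖v₀ x‖ₑ ^ 2 :=
            lintegral_mono fun x => mul_le_of_le_one_right zero_le
              (ENNReal.ofReal_le_one.2 (hψ1 x))
    -- the flux
    have hvmbox : AEStronglyMeasurable (uncurry v)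
        (volume.restrict (Ioo 0 s ×ˢ ball (0 : EuclideanSpace ℝ (Fin 3)) c)) := by
      rw [← hbox]
      exact hvmS s _
    have hflux : (∫⁻ z in Ioo 0 s ×ˢ ball (0 : EuclideanSpace ℝ (Fin 3)) c, ‖‖v z.1 z.2‖ ^ 2 * Δ ψ z.2 + (‖v z.1 z.2‖ ^ 2 + 2 * ϖ z.1 z.2) * ⟪v z.1 z.2, gradient ψ z.2⟫‖ₑ) ≤
        ENNReal.ofReal MΔ * (∫⁻ z in Ioo 0 s ×ˢ ball (0 : EuclideanSpace ℝ (Fin 3)) c, ‖v z.1 z.2‖ₑ ^ 2) + 3 * ENNReal.ofReal Mg * (∫⁻ z in Ioo 0 s ×ˢ ball (0 : EuclideanSpace ℝ (Fin 3)) c, ‖v z.1 z.2‖ₑ ^ (3 : ℕ)) +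
          2 * ENNReal.ofReal Mg * (∫⁻ z in Ioo 0 s ×ˢ ball (0 : EuclideanSpace ℝ (Fin 3)) c, ‖ϖ z.1 z.2‖ₑ ^ (3 / 2 : ℝ)) :=
      lintegral_enorm_flux_le (ϖ := ϖ) hMg0 hMΔ0 hMg hMΔ hvmbox
    -- the quadratic term: `∫∫_{(0,s)×B_λ}|v|² ≤ λ ∫₀ˢ α̃`
    have hI2 : (∫⁻ z in Ioo 0 s ×ˢ ball (0 : EuclideanSpace ℝ (Fin 3)) c, ‖v z.1 z.2‖ₑ ^ 2) ≤ ENNReal.ofReal c * (∫⁻ σ in Ioo 0 s, essSup (ballEnergy v) (volume.restrict (Ioo 0 σ))) := by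
      calc (∫⁻ z in Ioo 0 s ×ˢ ball (0 : EuclideanSpace ℝ (Fin 3)) c, ‖v z.1 z.2‖ₑ ^ 2)
          ≤ ∫⁻ σ in Ioo 0 s, ∫⁻ x in ball (0 : EuclideanSpace ℝ (Fin 3)) c, ‖v σ x‖ₑ ^ 2 := by
            rw [← hbox]
            exact lintegral_prod_le _
        _ = ∫⁻ σ in Ioo 0 s, ENNReal.ofReal c * ballEnergy v ((c ^ 2)⁻¹ * σ) :=
            lintegral_congr fun σ => setLIntegral_ball_enorm_sq_eq_ballEnergy hc0 hdss σ
        _ ≤ ∫⁻ σ in Ioo 0 s, ENNReal.ofReal c * essSup (ballEnergy v) (volume.restrict (Ioo 0 σ)) := by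
            refine lintegral_mono_ae ?_
            filter_upwards [hmET s] with σ hσ
            refine mul_le_mul' le_rfl ?_
            have h := hσ 0
            rwa [zero_add, pow_one] at h
        _ = ENNReal.ofReal c * (∫⁻ σ in Ioo 0 s, essSup (ballEnergy v) (volume.restrict (Ioo 0 σ))) := lintegral_const_mul' _ _ hc'top
    -- assembling (3.7)–(3.11)
    have hDfin_s : (∫⁻ z in Ioo 0 s ×ˢ ball (0 : EuclideanSpace ℝ (Fin 3)) 1, ENNReal.ofReal (frobeniusNormSq (G z.1 z.2))) ≠ ⊤ :=
      ne_top_of_le_ne_top hDfin (lintegral_mono_set (Set.prod_mono (Ioo_subset_Ioo_right hs1) Subset.rfl))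
    have hmain : ballEnergy v s + 2 * (∫⁻ z in Ioo 0 s ×ˢ ball (0 : EuclideanSpace ℝ (Fin 3)) 1, ENNReal.ofReal (frobeniusNormSq (G z.1 z.2))) ≤
        (∫⁻ x in ball (0 : EuclideanSpace ℝ (Fin 3)) c, ‖v₀ x‖ₑ ^ 2) + (∫⁻ z in Ioo 0 s ×ˢ ball (0 : EuclideanSpace ℝ (Fin 3)) 1, ENNReal.ofReal (frobeniusNormSq (G z.1 z.2))) + KA * (∫⁻ σ in Ioo 0 s, (essSup (ballEnergy v) (volume.restrict (Ioo 0 σ)) ^ 3 + essSup (ballEnergy v) (volume.restrict (Ioo 0 σ)))) := by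
      calc ballEnergy v s + 2 * (∫⁻ z in Ioo 0 s ×ˢ ball (0 : EuclideanSpace ℝ (Fin 3)) 1, ENNReal.ofReal (frobeniusNormSq (G z.1 z.2)))
          ≤ (∫⁻ x, ‖v s x‖ₑ ^ 2 * ENNReal.ofReal (ψ x)) +
              2 * ∫⁻ z in Ioo 0 s ×ˢ ball (0 : EuclideanSpace ℝ (Fin 3)) c,
                ENNReal.ofReal (frobeniusNormSq (G z.1 z.2)) * ENNReal.ofReal (ψ z.2) :=
            add_le_add hαψ (mul_le_mul' le_rfl hDψ)
        _ ≤ (∫⁻ x, ‖v₀ x‖ₑ ^ 2 * ENNReal.ofReal (ψ x)) + (∫⁻ z in Ioo 0 s ×ˢ ball (0 : EuclideanSpace ℝ (Fin 3)) c, ‖‖v z.1 z.2‖ ^ 2 * Δ ψ z.2 + (‖v z.1 z.2‖ ^ 2 + 2 * ϖ z.1 z.2) * ⟪v z.1 z.2, gradient ψ z.2⟫‖ₑ) := hs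
        _ ≤ (∫⁻ x in ball (0 : EuclideanSpace ℝ (Fin 3)) c, ‖v₀ x‖ₑ ^ 2) + (ENNReal.ofReal MΔ * (∫⁻ z in Ioo 0 s ×ˢ ball (0 : EuclideanSpace ℝ (Fin 3)) c, ‖v z.1 z.2‖ₑ ^ 2) + 3 * ENNReal.ofReal Mg * (∫⁻ z in Ioo 0 s ×ˢ ball (0 : EuclideanSpace ℝ (Fin 3)) c, ‖v z.1 z.2‖ₑ ^ (3 : ℕ)) +
              2 * ENNReal.ofReal Mg * (∫⁻ z in Ioo 0 s ×ˢ ball (0 : EuclideanSpace ℝ (Fin 3)) c, ‖ϖ z.1 z.2‖ₑ ^ (3 / 2 : ℝ))) := add_le_add hdat hflux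
        _ ≤ (∫⁻ x in ball (0 : EuclideanSpace ℝ (Fin 3)) c, ‖v₀ x‖ₑ ^ 2) + (ENNReal.ofReal MΔ * (ENNReal.ofReal c * (∫⁻ σ in Ioo 0 s, essSup (ballEnergy v) (volume.restrict (Ioo 0 σ)))) +
              3 * ENNReal.ofReal Mg * (ENNReal.ofReal (c ^ 2) * (∫⁻ z in Ioo 0 s ×ˢ ball (0 : EuclideanSpace ℝ (Fin 3)) 1, ‖v z.1 z.2‖ₑ ^ (3 : ℕ))) +
              2 * ENNReal.ofReal Mg * (Cp * (ENNReal.ofReal ((c ^ m') ^ 2) * (∫⁻ z in Ioo 0 s ×ˢ ball (0 : EuclideanSpace ℝ (Fin 3)) 1, ‖v z.1 z.2‖ₑ ^ (3 : ℕ))) +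
                Cp * (∫⁻ σ in Ioo 0 s, essSup (ballEnergy v) (volume.restrict (Ioo 0 σ)) ^ (3 / 2 : ℝ)))) :=
            add_le_add le_rfl (add_le_add (add_le_add (mul_le_mul' le_rfl hI2)
              (mul_le_mul' le_rfl (hI3 s hs0))) (mul_le_mul' le_rfl ((hPs s hs1).trans
                (add_le_add (mul_le_mul' le_rfl (hG3 s hs0)) le_rfl))))
        _ = (∫⁻ x in ball (0 : EuclideanSpace ℝ (Fin 3)) c, ‖v₀ x‖ₑ ^ 2) + (ENNReal.ofReal MΔ * ENNReal.ofReal c * (∫⁻ σ in Ioo 0 s, essSup (ballEnergy v) (volume.restrict (Ioo 0 σ))) + Kc * (∫⁻ z in Ioo 0 s ×ˢ ball (0 : EuclideanSpace ℝ (Fin 3)) 1, ‖v z.1 z.2‖ₑ ^ (3 : ℕ)) +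
              2 * ENNReal.ofReal Mg * Cp * (∫⁻ σ in Ioo 0 s, essSup (ballEnergy v) (volume.restrict (Ioo 0 σ)) ^ (3 / 2 : ℝ))) := by
            rw [hKc]
            ring
        _ ≤ (∫⁻ x in ball (0 : EuclideanSpace ℝ (Fin 3)) c, ‖v₀ x‖ₑ ^ 2) + (ENNReal.ofReal MΔ * ENNReal.ofReal c * (∫⁻ σ in Ioo 0 s, (essSup (ballEnergy v) (volume.restrict (Ioo 0 σ)) ^ 3 + essSup (ballEnergy v) (volume.restrict (Ioo 0 σ)))) +
              ((∫⁻ z in Ioo 0 s ×ˢ ball (0 : EuclideanSpace ℝ (Fin 3)) 1, ENNReal.ofReal (frobeniusNormSq (G z.1 z.2))) + (Kc * CG * ENNReal.ofReal c ^ (3 / 2 : ℝ) + ENNReal.ofReal ((Kc * CG).toReal ^ 4) * ENNReal.ofReal c ^ 3) * (∫⁻ σ in Ioo 0 s, (essSup (ballEnergy v) (volume.restrict (Ioo 0 σ)) ^ 3 + essSup (ballEnergy v) (volume.restrict (Ioo 0 σ))))) +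
              2 * ENNReal.ofReal Mg * Cp * (∫⁻ σ in Ioo 0 s, (essSup (ballEnergy v) (volume.restrict (Ioo 0 σ)) ^ 3 + essSup (ballEnergy v) (volume.restrict (Ioo 0 σ))))) :=
            add_le_add le_rfl (add_le_add (add_le_add (mul_le_mul' le_rfl (hE1 s))
              (hΛJ hKctop s hs1)) (mul_le_mul' le_rfl (hE32 s)))
        _ = (∫⁻ x in ball (0 : EuclideanSpace ℝ (Fin 3)) c, ‖v₀ x‖ₑ ^ 2) + (∫⁻ z in Ioo 0 s ×ˢ ball (0 : EuclideanSpace ℝ (Fin 3)) 1, ENNReal.ofReal (frobeniusNormSq (G z.1 z.2))) + KA * (∫⁻ σ in Ioo 0 s, (essSup (ballEnergy v) (volume.restrict (Ioo 0 σ)) ^ 3 + essSup (ballEnergy v) (volume.restrict (Ioo 0 σ)))) := by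
            rw [hKA]
            ring
    -- absorb the dissipation (finite) into the left-hand side
    have h2D : ballEnergy v s + (∫⁻ z in Ioo 0 s ×ˢ ball (0 : EuclideanSpace ℝ (Fin 3)) 1, ENNReal.ofReal (frobeniusNormSq (G z.1 z.2))) + (∫⁻ z in Ioo 0 s ×ˢ ball (0 : EuclideanSpace ℝ (Fin 3)) 1, ENNReal.ofReal (frobeniusNormSq (G z.1 z.2))) ≤
        (∫⁻ x in ball (0 : EuclideanSpace ℝ (Fin 3)) c, ‖v₀ x‖ₑ ^ 2) + KA * (∫⁻ σ in Ioo 0 s, (essSup (ballEnergy v) (volume.restrict (Ioo 0 σ)) ^ 3 + essSup (ballEnergy v) (volume.restrict (Ioo 0 σ)))) + (∫⁻ z in Ioo 0 s ×ˢ ball (0 : EuclideanSpace ℝ (Fin 3)) 1, ENNReal.ofReal (frobeniusNormSq (G z.1 z.2))) := by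
      calc ballEnergy v s + (∫⁻ z in Ioo 0 s ×ˢ ball (0 : EuclideanSpace ℝ (Fin 3)) 1, ENNReal.ofReal (frobeniusNormSq (G z.1 z.2))) + (∫⁻ z in Ioo 0 s ×ˢ ball (0 : EuclideanSpace ℝ (Fin 3)) 1, ENNReal.ofReal (frobeniusNormSq (G z.1 z.2))) = ballEnergy v s + 2 * (∫⁻ z in Ioo 0 s ×ˢ ball (0 : EuclideanSpace ℝ (Fin 3)) 1, ENNReal.ofReal (frobeniusNormSq (G z.1 z.2))) := by ring
        _ ≤ (∫⁻ x in ball (0 : EuclideanSpace ℝ (Fin 3)) c, ‖v₀ x‖ₑ ^ 2) + (∫⁻ z in Ioo 0 s ×ˢ ball (0 : EuclideanSpace ℝ (Fin 3)) 1, ENNReal.ofReal (frobeniusNormSq (G z.1 z.2))) + KA * (∫⁻ σ in Ioo 0 s, (essSup (ballEnergy v) (volume.restrict (Ioo 0 σ)) ^ 3 + essSup (ballEnergy v) (volume.restrict (Ioo 0 σ)))) := hmain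
        _ = (∫⁻ x in ball (0 : EuclideanSpace ℝ (Fin 3)) c, ‖v₀ x‖ₑ ^ 2) + KA * (∫⁻ σ in Ioo 0 s, (essSup (ballEnergy v) (volume.restrict (Ioo 0 σ)) ^ 3 + essSup (ballEnergy v) (volume.restrict (Ioo 0 σ)))) + (∫⁻ z in Ioo 0 s ×ˢ ball (0 : EuclideanSpace ℝ (Fin 3)) 1, ENNReal.ofReal (frobeniusNormSq (G z.1 z.2))) := by ring
    have hfinal : ballEnergy v s + (∫⁻ z in Ioo 0 s ×ˢ ball (0 : EuclideanSpace ℝ (Fin 3)) 1, ENNReal.ofReal (frobeniusNormSq (G z.1 z.2))) ≤ (∫⁻ x in ball (0 : EuclideanSpace ℝ (Fin 3)) c, ‖v₀ x‖ₑ ^ 2) + KA * (∫⁻ σ in Ioo 0 s, (essSup (ballEnergy v) (volume.restrict (Ioo 0 σ)) ^ 3 + essSup (ballEnergy v) (volume.restrict (Ioo 0 σ)))) :=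
      (ENNReal.add_le_add_iff_right hDfin_s).1 h2D
    exact hfinal.trans (add_le_add le_rfl (mul_le_mul' le_self_add le_rfl))
  · -- ### (ii): the pressure bound for `s ∈ (0,1]`
    intro s hs
    have hs0 : 0 < s := hs.1
    have hs1 : s ≤ 1 := hs.2
    calc (∫⁻ z in Ioo 0 s ×ˢ ball (0 : EuclideanSpace ℝ (Fin 3)) c, ‖ϖ z.1 z.2‖ₑ ^ (3 / 2 : ℝ))
        ≤ Cp * (∫⁻ z in Ioo 0 s ×ˢ ball (0 : EuclideanSpace ℝ (Fin 3)) (2 * c), ‖v z.1 z.2‖ₑ ^ (3 : ℕ)) + Cp * (∫⁻ σ in Ioo 0 s, essSup (ballEnergy v) (volume.restrict (Ioo 0 σ)) ^ (3 / 2 : ℝ)) := hPs s hs1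
      _ ≤ Cp * (ENNReal.ofReal ((c ^ m') ^ 2) * (∫⁻ z in Ioo 0 s ×ˢ ball (0 : EuclideanSpace ℝ (Fin 3)) 1, ‖v z.1 z.2‖ₑ ^ (3 : ℕ))) + Cp * (∫⁻ σ in Ioo 0 s, (essSup (ballEnergy v) (volume.restrict (Ioo 0 σ)) ^ 3 + essSup (ballEnergy v) (volume.restrict (Ioo 0 σ)))) :=
          add_le_add (mul_le_mul' le_rfl (hG3 s hs0)) (mul_le_mul' le_rfl (hE32 s))
      _ = Λ' * (∫⁻ z in Ioo 0 s ×ˢ ball (0 : EuclideanSpace ℝ (Fin 3)) 1, ‖v z.1 z.2‖ₑ ^ (3 : ℕ)) + Cp * (∫⁻ σ in Ioo 0 s, (essSup (ballEnergy v) (volume.restrict (Ioo 0 σ)) ^ 3 + essSup (ballEnergy v) (volume.restrict (Ioo 0 σ)))) := by rw [hΛ', mul_assoc]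
      _ ≤ ((∫⁻ z in Ioo 0 s ×ˢ ball (0 : EuclideanSpace ℝ (Fin 3)) 1, ENNReal.ofReal (frobeniusNormSq (G z.1 z.2))) + (Λ' * CG * ENNReal.ofReal c ^ (3 / 2 : ℝ) + ENNReal.ofReal ((Λ' * CG).toReal ^ 4) * ENNReal.ofReal c ^ 3) * (∫⁻ σ in Ioo 0 s, (essSup (ballEnergy v) (volume.restrict (Ioo 0 σ)) ^ 3 + essSup (ballEnergy v) (volume.restrict (Ioo 0 σ))))) + Cp * (∫⁻ σ in Ioo 0 s, (essSup (ballEnergy v) (volume.restrict (Ioo 0 σ)) ^ 3 + essSup (ballEnergy v) (volume.restrict (Ioo 0 σ)))) :=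
          add_le_add (hΛJ hΛ'top s hs1) le_rfl
      _ ≤ KB * ((∫⁻ z in Ioo 0 s ×ˢ ball (0 : EuclideanSpace ℝ (Fin 3)) 1, ENNReal.ofReal (frobeniusNormSq (G z.1 z.2))) + (∫⁻ σ in Ioo 0 s, (essSup (ballEnergy v) (volume.restrict (Ioo 0 σ)) ^ 3 + essSup (ballEnergy v) (volume.restrict (Ioo 0 σ))))) := by
          rw [hKB]
          have e : (1 + (Λ' * CG * ENNReal.ofReal c ^ (3 / 2 : ℝ) + ENNReal.ofReal ((Λ' * CG).toReal ^ 4) * ENNReal.ofReal c ^ 3) + Cp) * ((∫⁻ z in Ioo 0 s ×ˢ ball (0 : EuclideanSpace ℝ (Fin 3)) 1, ENNReal.ofReal (frobeniusNormSq (G z.1 z.2))) + (∫⁻ σ in Ioo 0 s, (essSup (ballEnergy v) (volume.restrict (Ioo 0 σ)) ^ 3 + essSup (ballEnergy v) (volume.restrict (Ioo 0 σ))))) =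
              ((∫⁻ z in Ioo 0 s ×ˢ ball (0 : EuclideanSpace ℝ (Fin 3)) 1, ENNReal.ofReal (frobeniusNormSq (G z.1 z.2))) + (∫⁻ σ in Ioo 0 s, (essSup (ballEnergy v) (volume.restrict (Ioo 0 σ)) ^ 3 + essSup (ballEnergy v) (volume.restrict (Ioo 0 σ)))) + ((Λ' * CG * ENNReal.ofReal c ^ (3 / 2 : ℝ) + ENNReal.ofReal ((Λ' * CG).toReal ^ 4) * ENNReal.ofReal c ^ 3) * (∫⁻ z in Ioo 0 s ×ˢ ball (0 : EuclideanSpace ℝ (Fin 3)) 1, ENNReal.ofReal (frobeniusNormSq (G z.1 z.2))) + (Λ' * CG * ENNReal.ofReal c ^ (3 / 2 : ℝ) + ENNReal.ofReal ((Λ' * CG).toReal ^ 4) * ENNReal.ofReal c ^ 3) * (∫⁻ σ in Ioo 0 s, (essSup (ballEnergy v) (volume.restrict (Ioo 0 σ)) ^ 3 + essSup (ballEnergy v) (volume.restrict (Ioo 0 σ)))))) +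
                (Cp * (∫⁻ z in Ioo 0 s ×ˢ ball (0 : EuclideanSpace ℝ (Fin 3)) 1, ENNReal.ofReal (frobeniusNormSq (G z.1 z.2))) + Cp * (∫⁻ σ in Ioo 0 s, (essSup (ballEnergy v) (volume.restrict (Ioo 0 σ)) ^ 3 + essSup (ballEnergy v) (volume.restrict (Ioo 0 σ))))) := by ring
          rw [e]
          exact add_le_add (add_le_add le_self_add le_add_self) le_add_self
      _ ≤ (KA + KB) * ((∫⁻ z in Ioo 0 s ×ˢ ball (0 : EuclideanSpace ℝ (Fin 3)) 1, ENNReal.ofReal (frobeniusNormSq (G z.1 z.2))) + (∫⁻ σ in Ioo 0 s, (essSup (ballEnergy v) (volume.restrict (Ioo 0 σ)) ^ 3 + essSup (ballEnergy v) (volume.restrict (Ioo 0 σ))))) := mul_le_mul' le_add_self le_rfl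

end BradshawTsai2019

end Literature.Analysis.FluidPDE

end
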